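import Summits.Ventures.YMGap.Census.TwistCensusObjects
import HarnessLib

/-!
# Venture YMGap, track (b) census — Tomboulis's mod-2 rule and the SUPPORT RULE of the character expansion on a
# RECTANGULAR torus `L₀ × ⋯ × L_{d-1}` (port of `VortexTwistCohomology` / `OneCharacterExpansion` rev. 2, cubic → rectangular)

HONEST FRAMING: venture file of the cell `pub-ymgap` (QuantumFields programme), track (b).  Algebraic identities between
finite-dimensional Haar integrals on finite rectangular tori; no signs, no limits, no physics claim.  Companion of
`Census/TwistCensusObjects.lean` (objects) and `Conjectures/TwistCensusParity.lean` (the typed laws): the two facts every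
exact census engine uses and that the tree so far had only for the CUBIC torus `(ℤ/Lℤ)^d`:

* **mod-2 rule** `rectTorusZtw_symmDiff_coboundary`: `Z⁻_{V ∆ δE} = Z⁻_V` for every twist set `V` and link set `E`
  (Tomboulis arXiv:0707.2179 §4, text after (4.1): the change of variables `U_b ↦ −U_b` on the bonds of `E`) — the twisted
  partition function depends on the twist set only through its class modulo coboundaries (this is why the engines may
  put the twist stack `𝒱_{ij}` anywhere in its class and reduce by translations);
* **support rule** `rectCharMoment_eq_zero_of_odd_inter_coboundary`: the Haar moment `I(S) = ∫ ∏_{p∈S} χ_{1/2}(U_p)`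
  vanishes unless `S` meets every coboundary evenly, i.e. unless every link lies in an even number of plaquettes of `S`
  (`S` a mod-2 cycle, "no free bond") — the enumeration domain of charexp / tmchar and step (i) of mechanism N-3 behind the
  germ law (G).

Everything is the cubic proof verbatim with `Site d L ↦ RectTorusSite Ls`, `x.shift i ↦ x + Pi.single i 1`; the `SU(2)`
facts (`negOne`, `su2Char_negOne_mul`, `plaqFn_negOne_mul`, `plaqFnTwist_negOne_mul`) are imported from
`Literature/MathematicalPhysics/QuantumFieldTheory/VortexTwistCohomology.lean`.
References: E. T. Tomboulis, arXiv:0707.2179 §4 (text after (4.1)), §6 (text before (6.2))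
[cite: Tomboulis2007Confinement, §4 (text after eq. (4.1))].
-/

noncomputable section

open MeasureTheory Finset Real
open scoped BigOperators symmDiff
open Literature.MathematicalPhysics.QuantumLattice
open Literature.MathematicalPhysics.QuantumFieldTheory
open Literature.MathematicalPhysics.QuantumFieldTheory.Tomboulis2007

namespace Summit.Ventures.YMGap.Census

variable {d : ℕ} {Ls : Fin d → ℕ}

/-! ### `SU(2)` plumbing (local copies of private lemmas of `VortexTwistCohomology`) -/

/-- `(-𝟙)⁻¹ = -𝟙`. [folklore] -/
private theorem negOne_inv' : (negOne : SU2)⁻¹ = negOne := by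
  rw [inv_eq_iff_mul_eq_one, negOne_mul_negOne]

/-- `(-U)⁻¹ = -U⁻¹`. [folklore] -/
private theorem negOne_mul_inv' (U : SU2) : (negOne * U)⁻¹ = negOne * U⁻¹ := by
  rw [mul_inv_rev, negOne_inv', negOne_mul_comm]

/-- `(-𝟙)^k = 𝟙` for even `k`. [folklore] -/
private theorem negOne_pow_of_even' {k : ℕ} (hk : Even k) : (negOne : SU2) ^ k = 1 := by
  obtain ⟨m, rfl⟩ := hk
  rw [← two_mul, pow_mul, pow_two, negOne_mul_negOne, one_pow]

/-- `(-𝟙)^k = -𝟙` for odd `k`. [folklore] -/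
private theorem negOne_pow_of_odd' {k : ℕ} (hk : Odd k) : (negOne : SU2) ^ k = negOne := by
  obtain ⟨m, rfl⟩ := hk
  rw [pow_succ, pow_mul, pow_two, negOne_mul_negOne, one_pow, one_mul]

/-- `χ_{1/2}((-𝟙)^k W) = (-1)^k χ_{1/2}(W)`. [folklore] -/
private theorem su2Char_one_negOne_pow_mul' (k : ℕ) (W : SU2) :
    su2Char 1 (negOne ^ k * W) = (-1 : ℝ) ^ k * su2Char 1 W := by
  induction k generalizing W with
  | zero => simp
  | succ k ih =>
    rw [pow_succ, mul_assoc, ih (negOne * W), su2Char_negOne_mul, pow_succ]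
    ring

/-! ### The change of variables `U_b ↦ -U_b` on a set of links of the rectangular torus -/

/-- The sign carried by a link under the flip along `E`: `-𝟙` on the links of `E`, `𝟙` elsewhere. [folklore] -/
def rectLinkSign (E : Finset (RectEdge Ls)) (e : RectEdge Ls) : SU2 := if e ∈ E then negOne else 1

/-- **Tomboulis's change of variables** `U_b ↦ -U_b` for `b ∈ E` on the rectangular torus.
[cite: Tomboulis2007Confinement, §4 (text after (4.1))] -/
def rectFlipLinks (E : Finset (RectEdge Ls)) (U : RectGaugeConfig Ls SU2) : RectGaugeConfig Ls SU2 :=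
  fun e => rectLinkSign E e * U e

/-- Each link sign is an involution (plumbing). -/
private theorem rectLinkSign_mul_self (E : Finset (RectEdge Ls)) (e : RectEdge Ls) :
    rectLinkSign E e * rectLinkSign E e = 1 := by
  unfold rectLinkSign
  split_ifs
  · exact negOne_mul_negOne
  · exact one_mul 1

/-- Each link sign is central (plumbing). -/
private theorem rectLinkSign_mul_comm (E : Finset (RectEdge Ls)) (e : RectEdge Ls) (U : SU2) :
    rectLinkSign E e * U = U * rectLinkSign E e := by
  unfold rectLinkSign
  split_ifs
  · exact negOne_mul_comm U
  · rw [one_mul, mul_one]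

/-- `(σ U)⁻¹ = σ U⁻¹` for a link sign `σ` (plumbing). -/
private theorem rectLinkSign_mul_inv (E : Finset (RectEdge Ls)) (e : RectEdge Ls) (U : SU2) :
    (rectLinkSign E e * U)⁻¹ = rectLinkSign E e * U⁻¹ := by
  unfold rectLinkSign
  split_ifs
  · exact negOne_mul_inv' U
  · rw [one_mul, one_mul]

/-- The link flip is an involution. [folklore] -/
theorem rectFlipLinks_rectFlipLinks (E : Finset (RectEdge Ls)) (U : RectGaugeConfig Ls SU2) :
    rectFlipLinks E (rectFlipLinks E U) = U := by
  funext e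
  simp only [rectFlipLinks, ← mul_assoc, rectLinkSign_mul_self, one_mul]

/-- The product of the four link signs around the plaquette at `x` in the `(i, j)` plane. [folklore] -/
def rectPlaqSign (E : Finset (RectEdge Ls)) (x : RectTorusSite Ls) (i j : Fin d) : SU2 :=
  rectLinkSign E (x, i) * rectLinkSign E (x + Pi.single i 1, j) * rectLinkSign E (x + Pi.single j 1, i) *
    rectLinkSign E (x, j)

/-- **The flipped holonomy** is the original one times the (central) product of the four boundary link signs.
[cite: Tomboulis2007Confinement, §4 (text after (4.1))] -/
theorem rectPlaquetteHolonomy_flipLinks (E : Finset (RectEdge Ls)) (U : RectGaugeConfig Ls SU2)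
    (x : RectTorusSite Ls) (i j : Fin d) :
    rectPlaquetteHolonomy (rectFlipLinks E U) x i j = rectPlaqSign E x i j * rectPlaquetteHolonomy U x i j := by
  simp only [rectPlaquetteHolonomy, rectFlipLinks, rectPlaqSign, rectLinkSign_mul_inv]
  set s₁ := rectLinkSign E (x, i)
  set s₂ := rectLinkSign E (x + Pi.single i 1, j)
  set s₃ := rectLinkSign E (x + Pi.single j 1, i)
  set s₄ := rectLinkSign E (x, j)
  have h₂ : ∀ V : SU2, s₂ * V = V * s₂ := rectLinkSign_mul_comm E _
  have h₃ : ∀ V : SU2, s₃ * V = V * s₃ := rectLinkSign_mul_comm E _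
  have h₄ : ∀ V : SU2, s₄ * V = V * s₄ := rectLinkSign_mul_comm E _
  calc s₁ * U (x, i) * (s₂ * U (x + Pi.single i 1, j)) * (s₃ * (U (x + Pi.single j 1, i))⁻¹) * (s₄ * (U (x, j))⁻¹)
      = s₁ * (U (x, i) * s₂) * U (x + Pi.single i 1, j) * s₃ * (U (x + Pi.single j 1, i))⁻¹ * s₄ * (U (x, j))⁻¹ := by
        simp only [mul_assoc]
    _ = s₁ * (s₂ * U (x, i)) * U (x + Pi.single i 1, j) * s₃ * (U (x + Pi.single j 1, i))⁻¹ * s₄ * (U (x, j))⁻¹ := by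
        rw [h₂]
    _ = s₁ * s₂ * (U (x, i) * U (x + Pi.single i 1, j) * s₃) * (U (x + Pi.single j 1, i))⁻¹ * s₄ * (U (x, j))⁻¹ := by
        simp only [mul_assoc]
    _ = s₁ * s₂ * (s₃ * (U (x, i) * U (x + Pi.single i 1, j))) * (U (x + Pi.single j 1, i))⁻¹ * s₄ * (U (x, j))⁻¹ := by
        rw [h₃]
    _ = s₁ * s₂ * s₃ * (U (x, i) * U (x + Pi.single i 1, j) * (U (x + Pi.single j 1, i))⁻¹ * s₄) * (U (x, j))⁻¹ := by
        simp only [mul_assoc]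
    _ = s₁ * s₂ * s₃ * (s₄ * (U (x, i) * U (x + Pi.single i 1, j) * (U (x + Pi.single j 1, i))⁻¹)) * (U (x, j))⁻¹ := by
        rw [h₄]
    _ = s₁ * s₂ * s₃ * s₄ * (U (x, i) * U (x + Pi.single i 1, j) * (U (x + Pi.single j 1, i))⁻¹ * (U (x, j))⁻¹) := by
        simp only [mul_assoc]

/-! ### Parity bookkeeping: the mod-2 coboundary of a link set -/

/-- Indicator of a link set. [folklore] -/
def rectLinkInd (E : Finset (RectEdge Ls)) (e : RectEdge Ls) : ℕ := if e ∈ E then 1 else 0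

/-- `k_p(E)`: the number of boundary slots of the plaquette `(x; i, j)` lying in `E` (with multiplicity). [folklore] -/
def rectFlipCount (E : Finset (RectEdge Ls)) (x : RectTorusSite Ls) (i j : Fin d) : ℕ :=
  rectLinkInd E (x, i) + rectLinkInd E (x + Pi.single i 1, j) + rectLinkInd E (x + Pi.single j 1, i) + rectLinkInd E (x, j)

/-- `σ_E(e) = (-𝟙)^{𝟙_E(e)}` (plumbing). -/
private theorem rectLinkSign_eq_pow (E : Finset (RectEdge Ls)) (e : RectEdge Ls) :
    rectLinkSign E e = negOne ^ rectLinkInd E e := by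
  unfold rectLinkSign rectLinkInd
  split_ifs <;> simp

/-- The plaquette sign is `(-𝟙)^{k_p(E)}` (plumbing). -/
private theorem rectPlaqSign_eq_pow (E : Finset (RectEdge Ls)) (x : RectTorusSite Ls) (i j : Fin d) :
    rectPlaqSign E x i j = negOne ^ rectFlipCount E x i j := by
  simp only [rectPlaqSign, rectFlipCount, rectLinkSign_eq_pow, pow_add]

variable [∀ i, NeZero (Ls i)]

/-- **The mod-2 coboundary `δE`** of a link set of the rectangular torus: the plaquettes with an odd number of boundary
slots in `E`. [folklore] -/
def rectCoboundary (E : Finset (RectEdge Ls)) : Finset (RectPlaquette Ls) :=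
  univ.filter fun p => Odd (rectFlipCount E p.1 p.2.1.1 p.2.1.2)

/-- Membership in the mod-2 coboundary. [folklore] -/
theorem mem_rectCoboundary (E : Finset (RectEdge Ls)) (p : RectPlaquette Ls) :
    p ∈ rectCoboundary E ↔ Odd (rectFlipCount E p.1 p.2.1.1 p.2.1.2) := by
  simp [rectCoboundary]

/-! ### Haar invariance of the link flip; the mod-2 rule -/

/-- **The change of variables `U_b ↦ -U_b` preserves the product Haar measure** (factorwise left translation by a
central element). [cite: Tomboulis2007Confinement, §4 (text after (4.1))] -/
theorem measurePreserving_rectFlipLinks (E : Finset (RectEdge Ls)) :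
    MeasurePreserving (rectFlipLinks E)
      (Measure.pi fun _ : RectEdge Ls => haarProbability SU2)
      (Measure.pi fun _ : RectEdge Ls => haarProbability SU2) :=
  measurePreserving_pi (f := fun (e : RectEdge Ls) (x : SU2) => rectLinkSign E e * x)
    (fun _ : RectEdge Ls => haarProbability SU2) (fun _ : RectEdge Ls => haarProbability SU2)
    fun e => measurePreserving_mul_left (haarProbability SU2) (rectLinkSign E e)

/-- The link flip as a measurable involution of `SU(2)^{links}`. [folklore] -/
def rectFlipEquiv (E : Finset (RectEdge Ls)) : RectGaugeConfig Ls SU2 ≃ᵐ RectGaugeConfig Ls SU2 where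
  toFun := rectFlipLinks E
  invFun := rectFlipLinks E
  left_inv := rectFlipLinks_rectFlipLinks E
  right_inv := rectFlipLinks_rectFlipLinks E
  measurable_toFun := (measurePreserving_rectFlipLinks E).measurable
  measurable_invFun := (measurePreserving_rectFlipLinks E).measurable

variable (Ls)

/-- **Tomboulis's mod-2 rule on the rectangular torus**: `Z⁻_{V ∆ δE}({c_j}) = Z⁻_V({c_j})` for every cut-off `J`,
coefficients `c`, twist set `V` and link set `E` — the twisted partition function depends on the twist only modulo
coboundaries (arXiv:0707.2179 §4, text after (4.1)). [cite: Tomboulis2007Confinement, §4 (text after eq. (4.1))] -/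
theorem rectTorusZtw_symmDiff_coboundary (J : ℕ) (c : ℕ → ℝ) (V : Finset (RectPlaquette Ls))
    (E : Finset (RectEdge Ls)) :
    rectTorusZtw Ls J c (V ∆ rectCoboundary E) = rectTorusZtw Ls J c V := by
  have hmp : MeasurePreserving (rectFlipEquiv E)
      (Measure.pi fun _ : RectEdge Ls => haarProbability SU2)
      (Measure.pi fun _ : RectEdge Ls => haarProbability SU2) :=
    measurePreserving_rectFlipLinks E
  unfold rectTorusZtw
  refine Eq.trans ?_ (hmp.integral_comp' (fun U : RectGaugeConfig Ls SU2 => ∏ p : RectPlaquette Ls,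
      (if p ∈ V then plaqFnTwist J c (rectPlaquetteHolonomy U p.1 p.2.1.1 p.2.1.2)
        else plaqFn J c (rectPlaquetteHolonomy U p.1 p.2.1.1 p.2.1.2))))
  congr 1
  funext U
  refine Finset.prod_congr rfl fun p _ => ?_
  change _ = (if p ∈ V then plaqFnTwist J c (rectPlaquetteHolonomy (rectFlipLinks E U) p.1 p.2.1.1 p.2.1.2)
      else plaqFn J c (rectPlaquetteHolonomy (rectFlipLinks E U) p.1 p.2.1.1 p.2.1.2))
  rw [rectPlaquetteHolonomy_flipLinks, rectPlaqSign_eq_pow]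
  rcases Nat.even_or_odd (rectFlipCount E p.1 p.2.1.1 p.2.1.2) with he | ho
  · have hp : p ∉ rectCoboundary E := by
      rw [mem_rectCoboundary]; exact Nat.not_odd_iff_even.mpr he
    rw [negOne_pow_of_even' he, one_mul]
    by_cases hV : p ∈ V
    · rw [if_pos (Finset.mem_symmDiff.mpr (Or.inl ⟨hV, hp⟩)), if_pos hV]
    · have h' : p ∉ V ∆ rectCoboundary E := by
        rw [Finset.mem_symmDiff]; tauto
      rw [if_neg h', if_neg hV]
  · have hp : p ∈ rectCoboundary E := (mem_rectCoboundary E p).mpr ho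
    rw [negOne_pow_of_odd' ho]
    by_cases hV : p ∈ V
    · have h' : p ∉ V ∆ rectCoboundary E := by
        rw [Finset.mem_symmDiff]; tauto
      rw [if_neg h', if_pos hV, plaqFnTwist_negOne_mul]
    · rw [if_pos (Finset.mem_symmDiff.mpr (Or.inr ⟨hp, hV⟩)), if_neg hV, plaqFn_negOne_mul]

/-- **A twist carried by a coboundary is invisible**: `Z⁻_{δE} = Z`. [cite: Tomboulis2007Confinement, §4 (text after eq. (4.1))] -/
theorem rectTorusZtw_coboundary (J : ℕ) (c : ℕ → ℝ) (E : Finset (RectEdge Ls)) :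
    rectTorusZtw Ls J c (rectCoboundary E) = rectTorusZ Ls J c := by
  rw [← rectTorusZtw_empty Ls J c, ← rectTorusZtw_symmDiff_coboundary Ls J c ∅ E]
  congr 1
  ext p
  simp [Finset.mem_symmDiff]

/-! ### The support rule: Haar moments vanish off the mod-2 cycles -/

variable {Ls}

omit [∀ i, NeZero (Ls i)] in
/-- The product of the twist signs over `S` is `(−1)^{|S ∩ W|}` (plumbing). -/
private theorem prod_ite_neg_one (W S : Finset (RectPlaquette Ls)) :
    ∏ p ∈ S, (if p ∈ W then (-1 : ℝ) else 1) = (-1 : ℝ) ^ (S ∩ W).card := by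
  rw [Finset.prod_ite, Finset.prod_const_one, mul_one, Finset.prod_const, Finset.filter_mem_eq_inter]

/-- **Flipping the bonds of `E` multiplies the support product by `(−1)^{|S ∩ δE|}`.**
[cite: Tomboulis2007Confinement, §4 (text after eq. (4.1))] -/
theorem prod_rectPlaqChar_flipLinks (E : Finset (RectEdge Ls)) (S : Finset (RectPlaquette Ls))
    (U : RectGaugeConfig Ls SU2) :
    ∏ p ∈ S, rectPlaqChar (rectFlipLinks E U) p =
      (-1 : ℝ) ^ (S ∩ rectCoboundary E).card * ∏ p ∈ S, rectPlaqChar U p := by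
  have hp : ∀ p ∈ S, rectPlaqChar (rectFlipLinks E U) p =
      (if p ∈ rectCoboundary E then (-1 : ℝ) else 1) * rectPlaqChar U p := by
    intro p _
    unfold rectPlaqChar
    rw [rectPlaquetteHolonomy_flipLinks, rectPlaqSign_eq_pow, su2Char_one_negOne_pow_mul']
    by_cases h : p ∈ rectCoboundary E
    · rw [if_pos h, ((mem_rectCoboundary E p).mp h).neg_one_pow]
    · rw [if_neg h, (Nat.not_odd_iff_even.mp (fun h' => h ((mem_rectCoboundary E p).mpr h'))).neg_one_pow]
  rw [Finset.prod_congr rfl hp, Finset.prod_mul_distrib, prod_ite_neg_one, mul_comm]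

variable (Ls)

/-- **Support rule of the character expansion on the rectangular torus**: if the plaquette set `S` meets the
coboundary `δE` of some link set `E` in an ODD number of plaquettes then `I(S) = rectCharMoment Ls S = 0`.  With
`E = {b}`: every link lies in an even number of plaquettes of a contributing `S` ("no free bond"; arXiv:0707.2179 §6,
text before (6.2)) — the enumeration domain of the exact census engines on `L₀ × L₁ × L₂`.
[cite: Tomboulis2007Confinement, §6 (text before eq. (6.2))] -/
theorem rectCharMoment_eq_zero_of_odd_inter_coboundary (S : Finset (RectPlaquette Ls)) (E : Finset (RectEdge Ls))
    (h : Odd (S ∩ rectCoboundary E).card) : rectCharMoment Ls S = 0 := by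
  have hmp : MeasurePreserving (rectFlipEquiv E)
      (Measure.pi fun _ : RectEdge Ls => haarProbability SU2)
      (Measure.pi fun _ : RectEdge Ls => haarProbability SU2) :=
    measurePreserving_rectFlipLinks E
  have h1 : rectCharMoment Ls S = (-1 : ℝ) ^ (S ∩ rectCoboundary E).card * rectCharMoment Ls S := by
    unfold rectCharMoment
    calc ∫ U, ∏ p ∈ S, rectPlaqChar U p ∂(Measure.pi fun _ : RectEdge Ls => haarProbability SU2)
        = ∫ U, ∏ p ∈ S, rectPlaqChar (rectFlipLinks E U) p ∂(Measure.pi fun _ : RectEdge Ls => haarProbability SU2) :=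
          (hmp.integral_comp' (fun U : RectGaugeConfig Ls SU2 => ∏ p ∈ S, rectPlaqChar U p)).symm
      _ = ∫ U, (-1 : ℝ) ^ (S ∩ rectCoboundary E).card * ∏ p ∈ S, rectPlaqChar U p
            ∂(Measure.pi fun _ : RectEdge Ls => haarProbability SU2) := by
          congr 1
          funext U
          exact prod_rectPlaqChar_flipLinks E S U
      _ = (-1 : ℝ) ^ (S ∩ rectCoboundary E).card *
            ∫ U, ∏ p ∈ S, rectPlaqChar U p ∂(Measure.pi fun _ : RectEdge Ls => haarProbability SU2) :=
          integral_const_mul _ _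
  rw [h.neg_one_pow] at h1
  linarith

/-- **The supports of the expansion are mod-2 cycles**: if `I(S) ≠ 0` then `S` meets EVERY coboundary evenly.
[cite: Tomboulis2007Confinement, §6 (text before eq. (6.2))] -/
theorem even_inter_rectCoboundary_of_rectCharMoment_ne_zero {S : Finset (RectPlaquette Ls)}
    (hS : rectCharMoment Ls S ≠ 0) (E : Finset (RectEdge Ls)) : Even (S ∩ rectCoboundary E).card := by
  by_contra h
  exact hS (rectCharMoment_eq_zero_of_odd_inter_coboundary Ls S E (Nat.not_even_iff_odd.mp h))

end Summit.Ventures.YMGap.Census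

end
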